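import Summits.Parity.GeneralizedHardyLittlewood.Theses.GoldbachSparseBridge

/-! # Glue of the split `SparseToEmpty ⟸ WindowSparse ∧ WindowBridge` (route-Parity-GoldbachSparseBridge)

HAND FILE (decomp-parity lens-5 g6, node «ShortWindowBridge»): proves the route's glue item `SparseToEmptyGlue :
WindowSparse → WindowBridge → SparseToEmpty` BY NAME on the born decls (one line: `WindowBridge` is `SparseExceptions →
WindowSparse → <eventual Goldbach>` and `SparseToEmpty` is `SparseExceptions → <eventual Goldbach>`), and records the
exactness of the split modulo the credited sibling and the trivial converse. [folklore] -/

namespace Summit.Parity.GeneralizedHardyLittlewood.GoldbachSparseBridgeSparseToEmptyGlue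

open Summit.Parity.GeneralizedHardyLittlewood.Theses.GoldbachSparseBridge

/-- The glue item, by name. -/
theorem sparseToEmptyGlue_holds : SparseToEmptyGlue := fun hS hW hA => hW hA hS

/-- The parent gives child 2 back (drop the extra hypothesis). -/
theorem windowBridge_of_sparseToEmpty (h : SparseToEmpty) : WindowBridge := fun hA _ => h hA

/-- Exactness of the split modulo the credited sibling `SparseExceptions`: given `A`, the parent is equivalent to
`(WindowSparse → nothing new) ∧ WindowBridge` — precisely, `SparseToEmpty ↔ WindowBridge` once `WindowSparse` holds. -/
theorem sparseToEmpty_iff_windowBridge_of_windowSparse (hS : WindowSparse) : SparseToEmpty ↔ WindowBridge :=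
  ⟨windowBridge_of_sparseToEmpty, fun hW => sparseToEmptyGlue_holds hS hW⟩

end Summit.Parity.GeneralizedHardyLittlewood.GoldbachSparseBridgeSparseToEmptyGlue
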